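import Summits.QuantumFields.BalabanUV.T4Continuum.Support.ScalarAveragedPropagator

/-!
# T⁴ programme, spine node NE2 (U1a), tier B support row B4.c (iii), file 3a — AN IN-BLOCK TRIAL FUNCTION on the blocks of
# [B5] (1.6)/(1.20): `ψ_φ(x) = φ(block x)·Π_ν b(digit_ν x)`, `b(t) = (t+1)(n−t)/n²`, with `Q′ψ_φ = β·φ` (`β ≥ 6^{−d}`),
# `nsq ψ_φ ≤ n^d·nsq φ`, `Σ_ν nsq (∂_νψ_φ) ≤ 4d·n^d·nsq φ` — the input of the variational bound of file 3b

NE2 formalisation swarm `b2b-balaban-t4-ne2-formalise-*`, leaf 09 (support row B4.c of `t4/formal/NE2/LEAVES.md`, item (iii) «n₁»: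
a k-UNIFORM bound on `‖(Q′G′²Q′*)⁻¹‖` for the `U = 1` scalar averaged propagator `G′ = (Δ + a′Π′)⁻¹` of file 2, the last `U = 1`
datum of row B4.b's factorisation of the gauge term of [Balaban1985BackgroundPropagators] (3.25)/(3.26)).  The uniform lower
bound on `Q′G′Q′*` (file 3b `Support/ScalarAveragedCompression`) is variational and needs a test function that is SMOOTH on the
lattice scale inside each block, has block averages proportional to a given unit-lattice function `φ`, and small face values; this
file builds it and proves its three estimates, by lattice bookkeeping only:

 * §1 the DIGITS of a fine site (`digits`, with `B5Blocks16.blockOf` the inverse of `B5Block118.bpt`) and the one-step moves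
   `n·y + j + e_ν = n·y + j[ν ↦ j_ν+1]` inside a block (`bpt_add_unitVec_of_lt`) / `= n·(y + e_ν) + j[ν ↦ 0]` across a face
   (`bpt_add_unitVec_of_eq`);
 * §2 the BUMP `b(t) = (t+1)(n−t)/n²`: `0 ≤ b ≤ 1`, `b(0) = b(n−1) = 1/n`, `|n(b(t+1) − b(t))| ≤ 1`, `6Σ_{t<n}(t+1)(n−t) = n(n+1)(n+2)`,
   `n⁻¹Σ_t b(t) = β₁ = (n+1)(n+2)/(6n²) ≥ 1/6`; the weight `W(j) = Π_ν b(j_ν) ∈ [0,1]` and **`trial n M φ`** with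
   **`QsOp_trial`** (`Q′ψ_φ = β₁^d·φ`), **`nsq_trial_le`** (`nsq ψ_φ ≤ n^d nsq φ`), `norm_step_trial_le`
   (`|n(ψ_φ(x + e_ν) − ψ_φ(x))| ≤ |φ(y)| + |φ(y + e_ν)|`, `x ∈ B(y)`) and **`dirichlet_trial_le`** (`Σ_ν nsq (∂_νψ_φ) ≤ 4d·n^d·nsq φ`).

HONEST FRAMING (T4-DAG p. 1).  [folklore] lattice bookkeeping about the cell's typed `U = 1` objects; statements / constants OURS;
nothing printed is a hypothesis.  `U = 1`, FIXED FINITE torus, scalar layer; a SUPPORT input of row B4.b, NOT B4, NOT [B9]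
(3.23)–(3.26) as printed; NE2 NOT proved; spine 0/9 unchanged; NOT infinite volume / mass gap / Clay / summit progress.  HONEST
DEPENDENCY: continuum YM on T⁴ ⇐ BetaPertH ∧ nine spine estimates (0/9 proved); BetaPertH ⇐ (D1) ∧ (D4) ∧ CAP+tail; G-an2-4 gates
asym, D1 and NE2/3/4.  ABSOLUTE RULE kept; zero sorries.
-/

noncomputable section

open scoped BigOperators ComplexConjugate ComplexOrder Matrix Matrix.Norms.L2Operator
open Finset

namespace Summit.QuantumFields.BalabanUV.T4Continuum.ScalarBlockTrialFunction

open Literature.MathematicalPhysics.QuantumFieldTheory.Balaban1983to89.B5Prop11Plancherel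
open Literature.MathematicalPhysics.QuantumFieldTheory.Balaban1983to89.B5Prop11Lower (nsq nsq_nonneg star_dotProduct_self
  norm_star_dotProduct_le)
open Literature.MathematicalPhysics.QuantumFieldTheory.Balaban1983to89.B5Action121 (sdiff LapS sdiff_mulVec star_mulVec_dotProduct)
open Literature.MathematicalPhysics.QuantumFieldTheory.Balaban1983to89.B5Block118 (tstep tstep_succ up iota bpt bpt_add_tstep QsOp QsOp_mulVec)
open Literature.MathematicalPhysics.QuantumFieldTheory.Balaban1983to89.B5Blocks16 (bpt_bijective blockOf blockOf_bpt)
open Literature.MathematicalPhysics.QuantumFieldTheory.Balaban1983to89.B5AverageCurlStokes (sum_blocks_real)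
open Summit.QuantumFields.BalabanUV.T4Continuum.ScalarBlockPoincare
open Summit.QuantumFields.BalabanUV.T4Continuum.ScalarAveragedPropagator

variable {d : ℕ}

/-! ## §1 Digits of a fine site; one-step moves of block points -/

section Digits

variable (n : ℕ) [NeZero n] (M : Fin d → ℕ) [hM : ∀ μ, NeZero (M μ)]

/-- the digits `j ∈ {0,…,n−1}^d` of a fine site `x = n·y + j`. [folklore] -/
def digits (x : Tor (fine n M)) : Fin d → Fin n := ((Equiv.ofBijective _ (bpt_bijective n M)).symm x).2

/-- `digits (n·y + j) = j`. [folklore] -/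
theorem digits_bpt (y : Tor M) (j : Fin d → Fin n) : digits n M (bpt n M y j) = j := by
  have h : (Equiv.ofBijective _ (bpt_bijective n M)).symm (bpt n M y j) = (y, j) :=
    (Equiv.ofBijective _ (bpt_bijective n M)).symm_apply_apply (y, j)
  rw [digits, h]

omit [NeZero n] hM in
/-- one step INSIDE the block: `n·y + j + e_ν = n·y + j[ν ↦ j_ν + 1]` when `j_ν + 1 < n`. [folklore] -/
theorem bpt_add_unitVec_of_lt (y : Tor M) (j : Fin d → Fin n) (ν : Fin d) (h : (j ν : ℕ) + 1 < n) :
    bpt n M y j + unitVec (fine n M) ν = bpt n M y (Function.update j ν ⟨(j ν : ℕ) + 1, h⟩) := by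
  funext μ
  simp only [bpt, iota, unitVec, Pi.add_apply, Function.update_apply]
  by_cases hμ : μ = ν
  · subst hμ; simp [Nat.cast_succ, add_assoc]
  · simp [hμ]

omit hM in
/-- moving one digit is a translation: `n·y + j[ν ↦ a] = n·y + j[ν ↦ 0] + a·e_ν` (cf. `T4AveragingDeficit.bpt_update`). [folklore] -/
theorem bpt_update' (y : Tor M) (j : Fin d → Fin n) (ν : Fin d) (a : Fin n) :
    bpt n M y (Function.update j ν a) = bpt n M y (Function.update j ν 0) + tstep (fine n M) ν (a : ℕ) := by
  funext μ
  simp only [bpt, iota, tstep, Pi.add_apply, Function.update_apply]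
  by_cases h : μ = ν
  · subst h; simp
  · simp [h]

omit hM in
/-- one step ACROSS a face: `n·y + j + e_ν = n·(y + e_ν) + j[ν ↦ 0]` when `j_ν + 1 = n`. [folklore] -/
theorem bpt_add_unitVec_of_eq (y : Tor M) (j : Fin d → Fin n) (ν : Fin d) (h : (j ν : ℕ) + 1 = n) :
    bpt n M y j + unitVec (fine n M) ν = bpt n M (y + unitVec M ν) (Function.update j ν 0) := by
  have h1 : bpt n M y j = bpt n M y (Function.update j ν 0) + tstep (fine n M) ν (j ν : ℕ) := by
    conv_lhs => rw [← Function.update_eq_self ν j]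
    exact bpt_update' n M y j ν (j ν)
  rw [h1, ← bpt_add_tstep, add_assoc, ← tstep_succ, h]

end Digits

/-! ## §2 The bump profile and the trial function -/

section Bump

variable (n : ℕ) [NeZero n] (M : Fin d → ℕ) [hM : ∀ μ, NeZero (M μ)]

/-- the in-block bump `b(t) = (t+1)(n−t)/n²`. [folklore] -/
def bump (n : ℕ) (t : ℕ) : ℝ := ((t : ℝ) + 1) * ((n : ℝ) - t) / (n : ℝ) ^ 2

omit [NeZero n] in
/-- `0 ≤ b(t) ≤ 1` for `t < n`. [folklore] -/
theorem bump_mem (t : ℕ) (ht : t < n) : 0 ≤ bump n t ∧ bump n t ≤ 1 := by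
  have hn : (0 : ℝ) < n := by exact_mod_cast (Nat.zero_lt_of_lt ht)
  have ht' : (t : ℝ) + 1 ≤ n := by exact_mod_cast ht
  have ht0 : (0 : ℝ) ≤ (n : ℝ) - t := by linarith
  unfold bump
  refine ⟨by positivity, ?_⟩
  rw [div_le_one (by positivity)]
  nlinarith

/-- `b(t) = 1/n` at a face (`t + 1 = n`, and symmetrically `t = 0`). [folklore] -/
theorem bump_face (t : ℕ) (ht : t + 1 = n) : bump n t = 1 / n ∧ bump n 0 = 1 / n := by
  have hn : (n : ℝ) = t + 1 := by exact_mod_cast ht.symm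
  have hn0 : (0 : ℝ) < n := by exact_mod_cast Nat.pos_of_ne_zero (NeZero.ne n)
  unfold bump
  constructor
  · rw [hn]; field_simp; ring
  · push_cast; field_simp; ring

omit [NeZero n] in
/-- `|n·(b(t+1) − b(t))| ≤ 1` inside the block (`t + 1 < n`). [folklore] -/
theorem abs_bump_step_le (t : ℕ) (ht : t + 1 < n) : |(n : ℝ) * (bump n (t + 1) - bump n t)| ≤ 1 := by
  have hn : (0 : ℝ) < n := by exact_mod_cast (Nat.zero_lt_of_lt ht)
  have ht' : (t : ℝ) + 2 ≤ n := by exact_mod_cast ht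
  have e : (n : ℝ) * (bump n (t + 1) - bump n t) = ((n : ℝ) - 2 * t - 2) / n := by
    unfold bump; push_cast; field_simp; ring
  rw [e, abs_div, abs_of_pos hn, div_le_one hn, abs_le]
  constructor <;> nlinarith

omit [NeZero n] in
/-- `6·Σ_{t<n} (t+1)(n−t) = n(n+1)(n+2)`. [folklore] -/
theorem six_mul_sum_eq (m : ℕ) : 6 * ∑ t ∈ Finset.range m, ((t : ℝ) + 1) * ((m : ℝ) - t) = (m : ℝ) * (m + 1) * (m + 2) := by
  induction m with
  | zero => simp
  | succ m ih =>
    have split : ∑ t ∈ Finset.range (m + 1), ((t : ℝ) + 1) * (((m + 1 : ℕ) : ℝ) - t)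
        = (∑ t ∈ Finset.range m, ((t : ℝ) + 1) * ((m : ℝ) - t)) + (∑ t ∈ Finset.range m, ((t : ℝ) + 1)) + (m + 1) := by
      rw [Finset.sum_range_succ, ← Finset.sum_add_distrib]
      push_cast
      congr 1
      · exact Finset.sum_congr rfl fun t _ => by ring
      · ring
    have gauss : ∑ t ∈ Finset.range m, ((t : ℝ) + 1) = (m : ℝ) * (m + 1) / 2 := by
      have h := Finset.sum_range_id_mul_two (m + 1)
      rw [Finset.sum_range_succ'] at h
      have h' : ((∑ t ∈ Finset.range m, (t + 1) : ℕ) : ℝ) * 2 = ((m + 1 : ℕ) : ℝ) * (m : ℝ) := by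
        have := congrArg (fun z : ℕ => (z : ℝ)) h
        push_cast at this ⊢
        simpa using this
      push_cast at h'
      linarith
    rw [split, mul_add, mul_add, ih, gauss]
    push_cast
    ring

omit [NeZero n] in
/-- `Σ_{t<n} b(t) = (n+1)(n+2)/(6n)`. [folklore] -/
theorem sum_bump_eq (hn : 0 < n) : ∑ t ∈ Finset.range n, bump n t = ((n : ℝ) + 1) * ((n : ℝ) + 2) / (6 * n) := by
  have hn' : (0 : ℝ) < n := by exact_mod_cast hn
  have h := six_mul_sum_eq n
  unfold bump
  rw [← Finset.sum_div]
  field_simp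
  linarith

/-- the block weight `β₁ = n⁻¹Σ_{t<n} b(t) = (n+1)(n+2)/(6n²)` and `1/6 ≤ β₁ ≤ 1`… we only need `β₁ ≥ 1/6` and `β₁ ≤ 1`. [folklore] -/
def beta1 (n : ℕ) : ℝ := ((n : ℝ) + 1) * ((n : ℝ) + 2) / (6 * (n : ℝ) ^ 2)

/-- `n⁻¹·Σ_{t : Fin n} b(t) = β₁`. [folklore] -/
theorem avg_bump_eq : ((n : ℝ))⁻¹ * ∑ t : Fin n, bump n t = beta1 n := by
  have hn : 0 < n := Nat.pos_of_ne_zero (NeZero.ne n)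
  have hn' : (0 : ℝ) < n := by exact_mod_cast hn
  rw [Fin.sum_univ_eq_sum_range (fun t => bump n t) n, sum_bump_eq n hn, beta1]
  field_simp

/-- `1/6 ≤ β₁`. [folklore] -/
theorem beta1_ge : 1 / 6 ≤ beta1 n ∧ 0 < beta1 n := by
  have hn' : (0 : ℝ) < n := by exact_mod_cast Nat.pos_of_ne_zero (NeZero.ne n)
  have h1 : 1 / 6 ≤ beta1 n := by
    unfold beta1
    rw [div_le_div_iff₀ (by norm_num) (by positivity)]
    nlinarith
  exact ⟨h1, lt_of_lt_of_le (by norm_num) h1⟩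

/-- the product weight `W(j) = Π_ν b(j_ν) ∈ [0, 1]`. [folklore] -/
def bumpW (j : Fin d → Fin n) : ℝ := ∏ ν, bump n (j ν)

omit [NeZero n] in
/-- `0 ≤ W(j) ≤ 1`. [folklore] -/
theorem bumpW_mem (j : Fin d → Fin n) : 0 ≤ bumpW n j ∧ bumpW n j ≤ 1 :=
  ⟨Finset.prod_nonneg fun ν _ => (bump_mem n (j ν) (j ν).is_lt).1,
   Finset.prod_le_one (fun ν _ => (bump_mem n (j ν) (j ν).is_lt).1) fun ν _ => (bump_mem n (j ν) (j ν).is_lt).2⟩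

omit [NeZero n] in
/-- splitting off one digit: `W(j) = b(j_ν)·Π_{μ≠ν} b(j_μ)` and the same for an updated digit. [folklore] -/
theorem bumpW_update (j : Fin d → Fin n) (ν : Fin d) (v : Fin n) :
    bumpW n (Function.update j ν v) = bump n v * ∏ μ ∈ Finset.univ.erase ν, bump n (j μ) ∧
    bumpW n j = bump n (j ν) * ∏ μ ∈ Finset.univ.erase ν, bump n (j μ) := by
  constructor
  · unfold bumpW
    rw [← Finset.mul_prod_erase Finset.univ _ (Finset.mem_univ ν), Function.update_self]
    congr 1
    exact Finset.prod_congr rfl fun μ hμ => by rw [Function.update_of_ne (Finset.ne_of_mem_erase hμ)]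
  · unfold bumpW
    rw [← Finset.mul_prod_erase Finset.univ _ (Finset.mem_univ ν)]

omit [NeZero n] in
/-- the remaining product is in `[0, 1]`. [folklore] -/
theorem prod_erase_mem (j : Fin d → Fin n) (ν : Fin d) :
    0 ≤ ∏ μ ∈ Finset.univ.erase ν, bump n (j μ) ∧ ∏ μ ∈ Finset.univ.erase ν, bump n (j μ) ≤ 1 :=
  ⟨Finset.prod_nonneg fun μ _ => (bump_mem n (j μ) (j μ).is_lt).1,
   Finset.prod_le_one (fun μ _ => (bump_mem n (j μ) (j μ).is_lt).1) fun μ _ => (bump_mem n (j μ) (j μ).is_lt).2⟩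

/-- **the trial function** `ψ_φ(x) = φ(block x)·W(digits x)`. [folklore] -/
def trial (φ : Tor M → ℂ) : Tor (fine n M) → ℂ := fun x => φ (blockOf n M x) * ((bumpW n (digits n M x) : ℝ) : ℂ)

/-- `ψ_φ(n·y + j) = φ(y)·W(j)`. [folklore] -/
theorem trial_bpt (φ : Tor M → ℂ) (y : Tor M) (j : Fin d → Fin n) :
    trial n M φ (bpt n M y j) = φ y * ((bumpW n j : ℝ) : ℂ) := by
  rw [trial, blockOf_bpt, digits_bpt]

/-- `Σ_j W(j) = (Σ_t b(t))^d = (n·β₁)^d`. [folklore] -/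
theorem sum_bumpW_eq : ∑ j : Fin d → Fin n, bumpW n j = ((n : ℝ) * beta1 n) ^ d := by
  have hn' : (n : ℝ) ≠ 0 := by exact_mod_cast NeZero.ne n
  have h1 : ∑ j : Fin d → Fin n, bumpW n j = ∏ _ν : Fin d, ∑ t : Fin n, bump n t := by
    unfold bumpW
    rw [Fintype.prod_sum (fun (_ν : Fin d) (t : Fin n) => bump n t)]
  have h2 : ∑ t : Fin n, bump n t = (n : ℝ) * beta1 n := by
    rw [← avg_bump_eq n]; field_simp
  rw [h1, h2, Finset.prod_const, Finset.card_univ, Fintype.card_fin]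

/-- **`Q′ψ_φ = β·φ`** with `β = β₁^d`. [folklore] -/
theorem QsOp_trial (φ : Tor M → ℂ) : QsOp n M *ᵥ trial n M φ = (((beta1 n) ^ d : ℝ) : ℂ) • φ := by
  have hn' : (n : ℂ) ≠ 0 := by exact_mod_cast NeZero.ne n
  funext y
  rw [QsOp_mulVec, Pi.smul_apply, smul_eq_mul]
  simp only [trial_bpt]
  rw [← Finset.mul_sum, ← Complex.ofReal_sum, sum_bumpW_eq n, mul_pow]
  push_cast
  field_simp

/-- `nsq ψ_φ ≤ n^d·nsq φ` (`W ≤ 1`). [folklore] -/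
theorem nsq_trial_le (φ : Tor M → ℂ) : nsq (trial n M φ) ≤ (n : ℝ) ^ d * nsq φ := by
  have hcard : (Fintype.card (Fin d → Fin n) : ℝ) = (n : ℝ) ^ d := by
    rw [Fintype.card_fun, Fintype.card_fin, Fintype.card_fin]; push_cast; ring
  unfold nsq
  rw [sum_blocks_real n M (fun x => ‖trial n M φ x‖ ^ 2), Finset.mul_sum]
  refine Finset.sum_le_sum fun y _ => ?_
  calc ∑ j : Fin d → Fin n, ‖trial n M φ (bpt n M y j)‖ ^ 2 ≤ ∑ _j : Fin d → Fin n, ‖φ y‖ ^ 2 := by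
        refine Finset.sum_le_sum fun j _ => ?_
        rw [trial_bpt, norm_mul, mul_pow, Complex.norm_real, Real.norm_of_nonneg (bumpW_mem n j).1]
        have h := (bumpW_mem n j).2
        have h0 := (bumpW_mem n j).1
        nlinarith [sq_nonneg ‖φ y‖, mul_le_one₀ h h0 h]
    _ = (n : ℝ) ^ d * ‖φ y‖ ^ 2 := by rw [Finset.sum_const, Finset.card_univ, nsmul_eq_mul, hcard]

/-- the one-step differences of `ψ_φ`: `|n·(ψ_φ(x + e_ν) − ψ_φ(x))| ≤ |φ(y)| + |φ(y + e_ν)|` at `x = n·y + j`. [folklore] -/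
theorem norm_step_trial_le (φ : Tor M → ℂ) (y : Tor M) (j : Fin d → Fin n) (ν : Fin d) :
    ‖(n : ℂ) * (trial n M φ (bpt n M y j + unitVec (fine n M) ν) - trial n M φ (bpt n M y j))‖ ≤ ‖φ y‖ + ‖φ (y + unitVec M ν)‖ := by
  set R : ℝ := ∏ μ ∈ Finset.univ.erase ν, bump n (j μ) with hR
  have hR0 : 0 ≤ R := (prod_erase_mem n j ν).1
  have hR1 : R ≤ 1 := (prod_erase_mem n j ν).2
  have hW : bumpW n j = bump n (j ν) * R := (bumpW_update n j ν 0).2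
  by_cases h : (j ν : ℕ) + 1 < n
  · -- inside the block
    have hW' : bumpW n (Function.update j ν ⟨(j ν : ℕ) + 1, h⟩) = bump n ((j ν : ℕ) + 1) * R := (bumpW_update n j ν _).1
    rw [bpt_add_unitVec_of_lt n M y j ν h, trial_bpt, trial_bpt, hW', hW]
    have e : (n : ℂ) * (φ y * (((bump n ((j ν : ℕ) + 1) * R : ℝ)) : ℂ) - φ y * (((bump n (j ν) * R : ℝ)) : ℂ))
        = φ y * ((((n : ℝ) * (bump n ((j ν : ℕ) + 1) - bump n (j ν)) * R : ℝ)) : ℂ) := by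
      push_cast; ring
    rw [e, norm_mul, Complex.norm_real, Real.norm_eq_abs, abs_mul, abs_of_nonneg hR0]
    have h1 := abs_bump_step_le n (j ν) h
    calc ‖φ y‖ * (|(n : ℝ) * (bump n ((j ν : ℕ) + 1) - bump n (j ν))| * R) ≤ ‖φ y‖ * (1 * 1) :=
          mul_le_mul_of_nonneg_left (mul_le_mul h1 hR1 hR0 zero_le_one) (norm_nonneg _)
      _ ≤ ‖φ y‖ + ‖φ (y + unitVec M ν)‖ := by rw [mul_one, mul_one]; linarith [norm_nonneg (φ (y + unitVec M ν))]
  · -- across a face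
    have heq : (j ν : ℕ) + 1 = n := by have := (j ν).is_lt; omega
    have hW' : bumpW n (Function.update j ν 0) = bump n ((0 : Fin n) : ℕ) * R := (bumpW_update n j ν 0).1
    have hb := bump_face n (j ν) heq
    rw [bpt_add_unitVec_of_eq n M y j ν heq, trial_bpt, trial_bpt, hW', hW, Fin.val_zero, hb.1, hb.2]
    have hn' : (n : ℂ) ≠ 0 := by exact_mod_cast NeZero.ne n
    have e : (n : ℂ) * (φ (y + unitVec M ν) * (((1 / (n : ℝ) * R : ℝ)) : ℂ) - φ y * (((1 / (n : ℝ) * R : ℝ)) : ℂ))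
        = (φ (y + unitVec M ν) - φ y) * ((R : ℝ) : ℂ) := by
      push_cast; field_simp; try ring
    rw [e, norm_mul, Complex.norm_real, Real.norm_of_nonneg hR0]
    calc ‖φ (y + unitVec M ν) - φ y‖ * R ≤ (‖φ (y + unitVec M ν)‖ + ‖φ y‖) * 1 :=
          mul_le_mul (norm_sub_le _ _) hR1 hR0 (by positivity)
      _ = ‖φ y‖ + ‖φ (y + unitVec M ν)‖ := by ring

/-- **`Σ_ν nsq (∂_νψ_φ) ≤ 4d·n^d·nsq φ`**. [folklore] -/
theorem dirichlet_trial_le (φ : Tor M → ℂ) : dirichlet n M (trial n M φ) ≤ 4 * d * ((n : ℝ) ^ d * nsq φ) := by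
  have hcard : (Fintype.card (Fin d → Fin n) : ℝ) = (n : ℝ) ^ d := by
    rw [Fintype.card_fun, Fintype.card_fin, Fintype.card_fin]; push_cast; ring
  have hν : ∀ ν : Fin d, nsq (sdiff (fine n M) (n : ℂ) ν *ᵥ trial n M φ) ≤ 4 * ((n : ℝ) ^ d * nsq φ) := by
    intro ν
    have hshift : ∑ y : Tor M, ‖φ (y + unitVec M ν)‖ ^ 2 = nsq φ :=
      Fintype.sum_equiv (Equiv.addRight (unitVec M ν)) _ _ fun y => rfl
    unfold nsq
    rw [sum_blocks_real n M (fun x => ‖(sdiff (fine n M) (n : ℂ) ν *ᵥ trial n M φ) x‖ ^ 2)]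
    calc ∑ y : Tor M, ∑ j : Fin d → Fin n, ‖(sdiff (fine n M) (n : ℂ) ν *ᵥ trial n M φ) (bpt n M y j)‖ ^ 2
        ≤ ∑ y : Tor M, ∑ _j : Fin d → Fin n, (2 * ‖φ y‖ ^ 2 + 2 * ‖φ (y + unitVec M ν)‖ ^ 2) := by
          refine Finset.sum_le_sum fun y _ => Finset.sum_le_sum fun j _ => ?_
          rw [sdiff_mulVec]
          have h := norm_step_trial_le n M φ y j ν
          have h2 := pow_le_pow_left₀ (norm_nonneg _) h 2
          nlinarith [h2, sq_nonneg (‖φ y‖ - ‖φ (y + unitVec M ν)‖)]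
      _ = (n : ℝ) ^ d * (2 * ∑ y : Tor M, ‖φ y‖ ^ 2 + 2 * ∑ y : Tor M, ‖φ (y + unitVec M ν)‖ ^ 2) := by
          simp only [Finset.sum_const, Finset.card_univ, nsmul_eq_mul, hcard]
          rw [← Finset.mul_sum, Finset.sum_add_distrib, Finset.mul_sum, Finset.mul_sum]
      _ = 4 * ((n : ℝ) ^ d * ∑ y : Tor M, ‖φ y‖ ^ 2) := by rw [hshift]; unfold nsq; ring
  calc dirichlet n M (trial n M φ) = ∑ ν : Fin d, nsq (sdiff (fine n M) (n : ℂ) ν *ᵥ trial n M φ) := rfl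
    _ ≤ ∑ _ν : Fin d, 4 * ((n : ℝ) ^ d * nsq φ) := Finset.sum_le_sum fun ν _ => hν ν
    _ = 4 * d * ((n : ℝ) ^ d * nsq φ) := by rw [Finset.sum_const, Finset.card_univ, Fintype.card_fin, nsmul_eq_mul]; ring

end Bump

end Summit.QuantumFields.BalabanUV.T4Continuum.ScalarBlockTrialFunction

end
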